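import Summits.BirchSwinnertonDyer.BirchSwinnertonDyer.Theorems.BiquadraticEisensteinDescentHeegnerTwistCouplingInSupplyQuarticMinusTripleDescentDual
import Summits.BirchSwinnertonDyer.BirchSwinnertonDyer.Theorems.BiquadraticEisensteinDescentHeegnerTwistCouplingInSupplyQuarticPlusCorner
import Literature.NumberTheory.EllipticCurves.QuarticTwistEntireLFunction
import Literature.NumberTheory.QuadraticFields.BinaryQuadraticFormsClassNumberCount
import Literature.NumberTheory.EllipticCurves.Rank1Residual.Predicates
import Literature.NumberTheory.EllipticCurves.Rank1Residual.X11RankOneCertificates.Minimality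
import HarnessLib

set_option linter.dupNamespace false -- `Summit.BirchSwinnertonDyer.BirchSwinnertonDyer.Theorems.…` (summit = sub)
set_option autoImplicit false

/-!
# Crux `HeegnerTwistCouplingInSupply` (stmt-BirchSwinnertonDyer-21381) — the QUARTIC `j = 1728` corner `W_p⁻ : y² = x³ − p·x`,
# TRIPLE TWIST, III: ★★ the generic rung `cruxOnQuarticMinusCornerTriple_of_BT`, modulo Burungale–Tian ONLY

Route `BiquadraticEisensteinDescent` (cell `pub/bsd-wall`, width seat `bsd-wall-cm-bed-w4` g14; `--supports` 21381, helper). Assembly of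
the triple-twist descent (`…QuarticMinusTripleDescent{,Dual}`): for the corner curve `W_p⁻ : y² = x³ − p·x` (`p ≡ 7 (mod 8)`, `j = 1728`,
CM by `ℤ[i]`, `p` inert and bad, root number `−1`) and ANY three primes

  `s ≡ 1 (mod 8)`, `(s/p) = −1`;  `q ≡ 3 (mod 8)`, `(q/p) = −1`;  `ℓ ≡ 5 (mod 8)`, `(ℓ/p) = −1`,

the twist `W_p⁻^{(−sqℓ)} : y² = x³ − s²q²ℓ²p·x` has `dim₂ S = dim₂ S′ = 1`, hence (UNCONDITIONALLY) `rank = 0`, `Ш[2] = 0`,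
`corank_{ℤ₂} Sel_{2^∞} = 0` (§1); `j = 1728` gives `HasCM`, so Burungale–Tian's rank-zero `2`-converse gives `r_an = 0`, which reads
`L(W_p⁻^{(−sqℓ)}, 1) ≠ 0` by the PROVED continuation `QuarticTwist.hasEntireLFunction` (Ireland–Rosen 18.6/18.7; NO Deuring–Hecke leaf);
`K′ = ℚ(√−sqℓ)` has `d_{K′} = −sqℓ ≡ 1 (mod 8)` and `(d_{K′}/p) = +1`, so it is Heegner for `N(W_p⁻)` (prime support `{2, p}`, bed-w4 g13's
`eq_two_or_eq_of_prime_dvd_conductorNorm_W`). Net, §3 ★★ `cruxOnQuarticMinusCornerTriple_of_BT`: for every prime `p ≡ 7 (mod 8)` and every such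
triple with `h(−sqℓ) < p`, the CONCLUSION of crux 21381 for `W = W_p⁻` — modulo Burungale–Tian ONLY. This is the H⁻ analogue of the
row-1 cell `(3,+)·(5,−)` of the `E_p` / `X_p` corners: a LEGENDRE-ONLY rung (bed-w4 g13's two-prime rungs `…QuarticPartnerCorner` need the
fourth-power symbol `p ∉ 𝔽_r^{×4}`); `…QuarticMinusTripleRows` discharges `h(−sqℓ) < p` by kernel rows below a bound. §2 holds the
symbols and the witness field; §4 the instance binders of the literal `W_p⁻` (`isElliptic_Wminus`, `isGloballyMinimal_Wminus`).

HONEST FRAMING: a typed sub-corner on ONE CM family (measure zero in «all CM `W`»); no pin for a SMALL `(1,−)`-prime `s` exists, so this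
rung is not an all-`p` theorem; the crux (residual C⁺ on the tail) is untouched; BSD is not proved by any of this. THEOREMS ONLY (no
definition, no new named fact, no `sorry`). Supports stmt-BirchSwinnertonDyer-21381.
-/

noncomputable section

open scoped Classical NumberField

namespace Summit.BirchSwinnertonDyer.BirchSwinnertonDyer.Theorems.BiquadraticEisensteinDescentHeegnerTwistCouplingInSupplyQuarticMinusTripleCorner

open _root_.WeierstrassCurve Literature.NumberTheory.EllipticCurves Literature.NumberTheory.EllipticCurves.XCubeAddPX
open Literature.NumberTheory.QuadraticFields Literature.NumberTheory.QuadraticFields.Quadratic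
open IsDedekindDomain Rat.HeightOneSpectrum
open Summit.BirchSwinnertonDyer.BirchSwinnertonDyer.Theorems.BiquadraticEisensteinDescentHeegnerTwistCouplingInSupplyQuarticTwistLocal
open Summit.BirchSwinnertonDyer.BirchSwinnertonDyer.Theorems.BiquadraticEisensteinDescentHeegnerTwistCouplingInSupplyQuarticTwistCorner
  (quadraticTwist_W j_and_hasCM_lit lit_eq eq_two_or_eq_of_prime_dvd_conductorNorm_W hasGoodReductionAtPrime_W)
open Summit.BirchSwinnertonDyer.BirchSwinnertonDyer.Theorems.BiquadraticEisensteinDescentHeegnerTwistCouplingInSupplyQuarticPlusCorner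
  (isSquare_of_jacobiSym_eq_one not_isSquare_of_jacobiSym_eq_neg_one)
open Summit.BirchSwinnertonDyer.BirchSwinnertonDyer.Theorems.BiquadraticEisensteinDescentHeegnerTwistCouplingInSupplyQuarticMinusTripleDescent
  (mem_selmer_neg_iff_triple)
open Summit.BirchSwinnertonDyer.BirchSwinnertonDyer.Theorems.BiquadraticEisensteinDescentHeegnerTwistCouplingInSupplyQuarticMinusTripleDescentDual
  (mem_selmer_pos_iff_triple)
open Summit.BirchSwinnertonDyer.BirchSwinnertonDyer.Theorems.BiquadraticEisensteinDescentHeegnerTwistCouplingInSupplySizeIndivisibleSharp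
  (classNumber_lt_of_sqrt_mul_log_lt)

/-! ## §1 The twist `E = W_p⁻^{(−sqℓ)} : y² = x³ − s²q²ℓ²p·x` -/

section Twist

variable {p q s l : ℕ} [hp : Fact p.Prime] [hq : Fact q.Prime] [hs : Fact s.Prime] [hl : Fact l.Prime]

/-- **Both Selmer sets have two elements**: `S(0, −s²q²ℓ²p) = {1, −p}`, `S′ = S(0, 4s²q²ℓ²p) = {1, p}`, so `dim₂ S = dim₂ S′ = 1`.
[cite: SilvermanAEC2009, Prop. X.4.9 and Prop. X.6.1] -/
theorem twoIsogenySelmerRank_triple (hp8 : p % 8 = 7) (hs8 : s % 8 = 1) (hq8 : q % 8 = 3) (hl8 : l % 8 = 5)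
    (hnq : ¬ IsSquare ((q : ℤ) : ZMod p)) (hps : ¬ IsSquare ((p : ℤ) : ZMod s)) (hpl : ¬ IsSquare ((p : ℤ) : ZMod l)) :
    twoIsogenySelmerRank 0 (-(s ^ 2 * q ^ 2 * l ^ 2 * p : ℤ)) = 1 ∧ twoIsogenySelmerRank' 0 (-(s ^ 2 * q ^ 2 * l ^ 2 * p : ℤ)) = 1 := by
  have hP := hp.out
  have h1p : (1 : ℤ) ≠ -(p : ℤ) := by have := hP.one_lt; omega
  have h1p' : (1 : ℤ) ≠ (p : ℤ) := by exact_mod_cast hP.one_lt.ne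
  have hS : twoIsogenySelmerGroup 0 (-(s ^ 2 * q ^ 2 * l ^ 2 * p : ℤ)) = {1, -(p : ℤ)} := by
    ext d
    rw [mem_selmer_neg_iff_triple hp8 hs8 hq8 hl8 hnq hps hpl, Finset.mem_insert, Finset.mem_singleton]
  have hS' : twoIsogenySelmerGroup' 0 (-(s ^ 2 * q ^ 2 * l ^ 2 * p : ℤ)) = {1, (p : ℤ)} := by
    rw [twoIsogenySelmerGroup'_eq, show (-2 * 0 : ℤ) = 0 by norm_num,
      show ((0 : ℤ) ^ 2 - 4 * (-(s ^ 2 * q ^ 2 * l ^ 2 * p : ℤ))) = 4 * s ^ 2 * q ^ 2 * l ^ 2 * p by ring]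
    ext d
    rw [mem_selmer_pos_iff_triple hp8 hs8 hq8 hl8 hnq hps hpl, Finset.mem_insert, Finset.mem_singleton]
  refine ⟨?_, ?_⟩
  · rw [twoIsogenySelmerRank, hS, Finset.card_pair h1p]
    exact Nat.log_pow Nat.one_lt_two 1
  · rw [twoIsogenySelmerRank'_eq, hS', Finset.card_pair h1p']
    exact Nat.log_pow Nat.one_lt_two 1

/-- ★ **`rank = 0`, `Ш[2] = 0`, `corank_{ℤ₂} Sel_{2^∞} = 0` for `E : y² = x³ − s²q²ℓ²p·x`** in the triple cell — UNCONDITIONAL (sharp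
descent via `2`-isogeny, then Greenberg's corank identity with `Ш[2^∞][2] = 0`). The literal `⟨0, ↑0, 0, ↑(−s²q²ℓ²p), 0⟩` is `W_p⁻^{(−sqℓ)}`.
[cite: SilvermanAEC2009, Prop. X.4.7 and Thm. X.4.2(a); Prop. X.6.1] [cite: Greenberg1999LNM, §1 pp. 54–57] -/
theorem rank_sha_corank_triple (hp8 : p % 8 = 7) (hs8 : s % 8 = 1) (hq8 : q % 8 = 3) (hl8 : l % 8 = 5)
    (hnq : ¬ IsSquare ((q : ℤ) : ZMod p)) (hps : ¬ IsSquare ((p : ℤ) : ZMod s)) (hpl : ¬ IsSquare ((p : ℤ) : ZMod l))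
    [hE : (⟨0, ((0 : ℤ) : ℚ), 0, ((-(s ^ 2 * q ^ 2 * l ^ 2 * p) : ℤ) : ℚ), 0⟩ : WeierstrassCurve ℚ).IsElliptic] :
    (⟨0, ((0 : ℤ) : ℚ), 0, ((-(s ^ 2 * q ^ 2 * l ^ 2 * p) : ℤ) : ℚ), 0⟩ : WeierstrassCurve ℚ).mordellWeilRank = 0 ∧
    (∀ c ∈ (⟨0, ((0 : ℤ) : ℚ), 0, ((-(s ^ 2 * q ^ 2 * l ^ 2 * p) : ℤ) : ℚ), 0⟩ : WeierstrassCurve ℚ).sha, 2 • c = 0 → c = 0) ∧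
    (⟨0, ((0 : ℤ) : ℚ), 0, ((-(s ^ 2 * q ^ 2 * l ^ 2 * p) : ℤ) : ℚ), 0⟩ : WeierstrassCurve ℚ).selmerCorank 2 = 0 := by
  have hP := hp.out
  have hp0 : (p : ℤ) ≠ 0 := by exact_mod_cast hP.ne_zero
  have hq0 : (q : ℤ) ≠ 0 := by exact_mod_cast hq.out.ne_zero
  have hs0 : (s : ℤ) ≠ 0 := by exact_mod_cast hs.out.ne_zero
  have hl0 : (l : ℤ) ≠ 0 := by exact_mod_cast hl.out.ne_zero
  have hb : (-(s ^ 2 * q ^ 2 * l ^ 2 * p : ℤ)) ≠ 0 :=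
    neg_ne_zero.mpr (mul_ne_zero (mul_ne_zero (mul_ne_zero (pow_ne_zero 2 hs0) (pow_ne_zero 2 hq0)) (pow_ne_zero 2 hl0)) hp0)
  have hab : (-(s ^ 2 * q ^ 2 * l ^ 2 * p : ℤ)) * ((0 : ℤ) ^ 2 - 4 * (-(s ^ 2 * q ^ 2 * l ^ 2 * p : ℤ))) ≠ 0 := by
    refine mul_ne_zero hb ?_
    rw [show ((0 : ℤ) ^ 2 - 4 * (-(s ^ 2 * q ^ 2 * l ^ 2 * p : ℤ))) = 4 * (s ^ 2 * q ^ 2 * l ^ 2 * p) by ring]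
    exact mul_ne_zero (by norm_num) (neg_ne_zero.mp hb)
  haveI := isElliptic_halfModel hab
  obtain ⟨h1, h2⟩ := twoIsogenySelmerRank_triple hp8 hs8 hq8 hl8 hnq hps hpl
  have hle : twoIsogenySelmerRank 0 (-(s ^ 2 * q ^ 2 * l ^ 2 * p : ℤ)) + twoIsogenySelmerRank' 0 (-(s ^ 2 * q ^ 2 * l ^ 2 * p : ℤ)) ≤
      (⟨0, ((0 : ℤ) : ℚ), 0, ((-(s ^ 2 * q ^ 2 * l ^ 2 * p) : ℤ) : ℚ), 0⟩ : WeierstrassCurve ℚ).mordellWeilRank + 2 := by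
    rw [h1, h2]; omega
  obtain ⟨-, -, hsum⟩ := natCard_sha_inf_range_eq_one_of_selmerRank_add_le hab hle
  have hrank : (⟨0, ((0 : ℤ) : ℚ), 0, ((-(s ^ 2 * q ^ 2 * l ^ 2 * p) : ℤ) : ℚ), 0⟩ : WeierstrassCurve ℚ).mordellWeilRank = 0 := by
    rw [h1, h2] at hsum; omega
  have hsha := forall_mem_sha_two_smul_eq_zero_of_selmerRank_add_le hab hle
  haveI : Fact (Nat.Prime 2) := ⟨Nat.prime_two⟩
  refine ⟨hrank, hsha, ?_⟩
  rw [(⟨0, ((0 : ℤ) : ℚ), 0, ((-(s ^ 2 * q ^ 2 * l ^ 2 * p) : ℤ) : ℚ), 0⟩ : WeierstrassCurve ℚ).selmerCorank_eq_mordellWeilRank_add_holds 2,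
    hrank, (⟨0, ((0 : ℤ) : ℚ), 0, ((-(s ^ 2 * q ^ 2 * l ^ 2 * p) : ℤ) : ℚ), 0⟩ : WeierstrassCurve ℚ).shaCorank_eq_zero_of_forall 2 hsha]

omit hp hq hs hl in
/-- `b = −s²q²ℓ²p` (`s, q, ℓ, p` distinct primes) is free of fourth powers. [folklore] -/
theorem not_pow_four_dvd_triple (hP : p.Prime) (hQ : q.Prime) (hS : s.Prime) (hL : l.Prime) (hsp : s ≠ p) (hqp : q ≠ p)
    (hlp : l ≠ p) (hsq : s ≠ q) (hsl : s ≠ l) (hql : q ≠ l) (r : ℕ) (hr : r.Prime) :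
    ¬ (r : ℤ) ^ 4 ∣ -(s ^ 2 * q ^ 2 * l ^ 2 * p : ℤ) := by
  intro h
  have h' : r ^ 4 ∣ s ^ 2 * q ^ 2 * l ^ 2 * p ^ 1 := by
    have := Int.natAbs_dvd_natAbs.mpr h
    simpa [Int.natAbs_mul, Int.natAbs_pow, Int.natAbs_neg] using this
  have hcop : ∀ {a b : ℕ} (m n : ℕ), a.Prime → b.Prime → a ≠ b → Nat.Coprime (a ^ m) (b ^ n) := fun m n ha hb hab =>
    Nat.Coprime.pow m n ((Nat.coprime_primes ha hb).mpr hab)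
  by_cases hrs : r = s
  · subst hrs
    have h1 : r ^ 4 ∣ r ^ 2 := by
      rw [show r ^ 2 * q ^ 2 * l ^ 2 * p ^ 1 = r ^ 2 * (q ^ 2 * l ^ 2 * p ^ 1) by ring] at h'
      exact (((hcop 4 2 hS hQ hsq).mul_right (hcop 4 2 hS hL hsl)).mul_right (hcop 4 1 hS hP hsp)).dvd_of_dvd_mul_right h'
    have := (Nat.pow_dvd_pow_iff_le_right hS.one_lt).mp h1
    omega
  by_cases hrq : r = q
  · subst hrq
    have h1 : r ^ 4 ∣ r ^ 2 := by
      rw [show s ^ 2 * r ^ 2 * l ^ 2 * p ^ 1 = r ^ 2 * (s ^ 2 * l ^ 2 * p ^ 1) by ring] at h'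
      exact (((hcop 4 2 hQ hS (Ne.symm hsq)).mul_right (hcop 4 2 hQ hL hql)).mul_right (hcop 4 1 hQ hP hqp)).dvd_of_dvd_mul_right h'
    have := (Nat.pow_dvd_pow_iff_le_right hQ.one_lt).mp h1
    omega
  by_cases hrl : r = l
  · subst hrl
    have h1 : r ^ 4 ∣ r ^ 2 := by
      rw [show s ^ 2 * q ^ 2 * r ^ 2 * p ^ 1 = r ^ 2 * (s ^ 2 * q ^ 2 * p ^ 1) by ring] at h'
      exact (((hcop 4 2 hL hS (Ne.symm hsl)).mul_right (hcop 4 2 hL hQ (Ne.symm hql))).mul_right (hcop 4 1 hL hP hlp)).dvd_of_dvd_mul_right h'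
    have := (Nat.pow_dvd_pow_iff_le_right hL.one_lt).mp h1
    omega
  by_cases hrp : r = p
  · subst hrp
    have h1 : r ^ 4 ∣ r ^ 1 := by
      rw [show s ^ 2 * q ^ 2 * l ^ 2 * r ^ 1 = r ^ 1 * (s ^ 2 * q ^ 2 * l ^ 2) by ring] at h'
      exact (((hcop 4 2 hP hS (Ne.symm hsp)).mul_right (hcop 4 2 hP hQ (Ne.symm hqp))).mul_right
        (hcop 4 2 hP hL (Ne.symm hlp))).dvd_of_dvd_mul_right h'
    have := (Nat.pow_dvd_pow_iff_le_right hP.one_lt).mp h1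
    omega
  · have hc : Nat.Coprime (r ^ 4) (s ^ 2 * q ^ 2 * l ^ 2 * p ^ 1) :=
      ((((hcop 4 2 hr hS hrs).mul_right (hcop 4 2 hr hQ hrq)).mul_right (hcop 4 2 hr hL hrl)).mul_right (hcop 4 1 hr hP hrp))
    have h1 : r ^ 4 ∣ 1 := hc.dvd_of_dvd_mul_right (by simpa using h')
    have := Nat.le_of_dvd one_pos h1
    have := Nat.one_lt_pow (n := 4) (by norm_num) hr.one_lt
    omega

/-- ★ **`L`-form, ONE named fact**: `r_an(E) = 0` and `L(E, 1) ≠ 0` for `E : y² = x³ − s²q²ℓ²p·x` in the triple cell, modulo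
Burungale–Tian's rank-zero `2`-converse for CM curves ONLY: the corank vanishes (`rank_sha_corank_triple`, unconditional), `j = 1728` gives
`HasCM`, and the continuation needed to read `r_an = 0` as `L(1) ≠ 0` is the tree theorem `QuarticTwist.hasEntireLFunction` (Ireland–Rosen
18.6/18.7), not a named fact. [cite: BurungaleTian2026, Thm. 1.1] [cite: IrelandRosen1990, Ch. 18 §6 Theorem 7] -/
theorem L_one_ne_zero_triple_of_BT (hBT : burungaleTian_analyticRank_eq_zero_of_selmerCorank_eq_zero_of_hasCM)
    (hp8 : p % 8 = 7) (hs8 : s % 8 = 1) (hq8 : q % 8 = 3) (hl8 : l % 8 = 5)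
    (hnq : ¬ IsSquare ((q : ℤ) : ZMod p)) (hps : ¬ IsSquare ((p : ℤ) : ZMod s)) (hpl : ¬ IsSquare ((p : ℤ) : ZMod l))
    [hE : (⟨0, ((0 : ℤ) : ℚ), 0, ((-(s ^ 2 * q ^ 2 * l ^ 2 * p) : ℤ) : ℚ), 0⟩ : WeierstrassCurve ℚ).IsElliptic] :
    (⟨0, ((0 : ℤ) : ℚ), 0, ((-(s ^ 2 * q ^ 2 * l ^ 2 * p) : ℤ) : ℚ), 0⟩ : WeierstrassCurve ℚ).analyticRank = 0 ∧
    (⟨0, ((0 : ℤ) : ℚ), 0, ((-(s ^ 2 * q ^ 2 * l ^ 2 * p) : ℤ) : ℚ), 0⟩ : WeierstrassCurve ℚ).entireLFunction 1 ≠ 0 := by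
  haveI : Fact (Nat.Prime 2) := ⟨Nat.prime_two⟩
  have hP := hp.out
  have hQ := hq.out
  have hS := hs.out
  have hL := hl.out
  have hb : (-(s ^ 2 * q ^ 2 * l ^ 2 * p : ℤ)) ≠ 0 :=
    neg_ne_zero.mpr (mul_ne_zero (mul_ne_zero (mul_ne_zero (pow_ne_zero 2 (by exact_mod_cast hS.ne_zero))
      (pow_ne_zero 2 (by exact_mod_cast hQ.ne_zero))) (pow_ne_zero 2 (by exact_mod_cast hL.ne_zero))) (by exact_mod_cast hP.ne_zero))
  obtain ⟨-, hCM⟩ := j_and_hasCM_lit hb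
  obtain ⟨-, -, hcor⟩ := rank_sha_corank_triple hp8 hs8 hq8 hl8 hnq hps hpl
  have h0 := hBT _ hCM 2 hcor
  have h4 := not_pow_four_dvd_triple hP hQ hS hL (by rintro rfl; omega) (by rintro rfl; omega) (by rintro rfl; omega)
    (by rintro rfl; omega) (by rintro rfl; omega) (by rintro rfl; omega)
  have hH := QuarticTwist.hasEntireLFunction hb h4
  rw [← lit_eq] at hH
  exact ⟨h0, (analyticRank_eq_zero_iff_holds
    (W := (⟨0, ((0 : ℤ) : ℚ), 0, ((-(s ^ 2 * q ^ 2 * l ^ 2 * p) : ℤ) : ℚ), 0⟩ : WeierstrassCurve ℚ)) hH).1 h0⟩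

end Twist

/-! ## §2 Symbols and the witness field `K′ = ℚ(√−sqℓ)` -/

section Field

/-- `(−sqℓ/p) = +1` in the triple cell: `p ≡ 3 (mod 4)` and `(s/p) = (q/p) = (ℓ/p) = −1`. [folklore] -/
theorem jacobiSym_neg_triple_eq_one {p s q l : ℕ} (hp4 : p % 4 = 3) (hJs : jacobiSym (s : ℤ) p = -1)
    (hJq : jacobiSym (q : ℤ) p = -1) (hJl : jacobiSym (l : ℤ) p = -1) : jacobiSym (-((s * q * l : ℕ) : ℤ)) p = 1 := by
  have hm1 : jacobiSym (-1) p = -1 := DeuringLadic.jacobiSym_neg_one_of_mod_four hp4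
  have : (-((s * q * l : ℕ) : ℤ)) = (-1) * (s : ℤ) * (q : ℤ) * (l : ℤ) := by push_cast; ring
  rw [this, jacobiSym.mul_left, jacobiSym.mul_left, jacobiSym.mul_left, hm1, hJs, hJq, hJl]
  norm_num

/-- From `(t/p) = −1` with `t ≡ 1 (mod 4)` prime and `p` an odd prime: `p` is a non-residue mod `t` (reciprocity `(p/t) = (t/p)`).
[folklore] -/
theorem not_isSquare_mod_of_jacobiSym_eq_neg_one {p t : ℕ} [Fact t.Prime] (hp2 : p % 2 = 1) (ht4 : t % 4 = 1)
    (hJ : jacobiSym (t : ℤ) p = -1) : ¬ IsSquare ((p : ℤ) : ZMod t) := by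
  have h : jacobiSym (p : ℤ) t = -1 := by
    rw [← jacobiSym.quadratic_reciprocity_one_mod_four ht4 (Nat.odd_iff.mpr hp2)]; exact hJ
  exact not_isSquare_of_jacobiSym_eq_neg_one h

/-- **The witness field of the triple cell.** For primes `s ≡ 1`, `q ≡ 3`, `ℓ ≡ 5 (mod 8)` and a prime `p` with `(−sqℓ/p) = +1`, given any
bound `h(·) < p` valid for every imaginary quadratic field of discriminant `−sqℓ`: `K′ = ℚ(√−sqℓ)` is imaginary quadratic,
`d_{K′} = −sqℓ ≡ 1 (mod 8)` (so `2` splits), Heegner for every level whose prime divisors lie in `{2, p}`, and `h(K′) < p`.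
[cite: Marcus2018, Ch. 2 Thm. 1; Ch. 3 Thm. 25] -/
theorem exists_witnessField_triple {p s q l : ℕ} (hs : s.Prime) (hs8 : s % 8 = 1) (hq : q.Prime) (hq8 : q % 8 = 3)
    (hl : l.Prime) (hl8 : l % 8 = 5) (hJ : jacobiSym (-((s * q * l : ℕ) : ℤ)) p = 1)
    (hh : ∀ (K : Type) [Field K] [NumberField K], IsImaginaryQuadratic K →
      NumberField.discr K = -((s * q * l : ℕ) : ℤ) → NumberField.classNumber K < p)
    {N : ℕ} (hN : ∀ r : ℕ, r.Prime → r ∣ N → r = 2 ∨ r = p) :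
    ∃ (K : Type) (_ : Field K) (_ : NumberField K),
      IsImaginaryQuadratic K ∧ NumberField.discr K = -((s * q * l : ℕ) : ℤ) ∧
      SatisfiesHeegnerHypothesis N K ∧ NumberField.classNumber K < p := by
  have hsq : s ≠ q := by rintro rfl; omega
  have hsl : s ≠ l := by rintro rfl; omega
  have hql : q ≠ l := by rintro rfl; omega
  haveI : Fact ((-((s * q * l : ℕ) : ℤ)) < 0) :=
    ⟨by have := hs.two_le; have := hq.two_le; have := hl.two_le; push_cast; nlinarith [Nat.mul_le_mul hs.two_le hq.two_le]⟩
  have hsf : Squarefree (-((s * q * l : ℕ) : ℤ)).natAbs := by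
    rw [Int.natAbs_neg, Int.natAbs_natCast]
    have hc1 : Nat.Coprime s q := (Nat.coprime_primes hs hq).mpr hsq
    have hc2 : Nat.Coprime s l := (Nat.coprime_primes hs hl).mpr hsl
    have hc3 : Nat.Coprime q l := (Nat.coprime_primes hq hl).mpr hql
    rw [Nat.squarefree_mul (Nat.Coprime.mul_left hc2 hc3), Nat.squarefree_mul hc1]
    exact ⟨⟨hs.squarefree, hq.squarefree⟩, hl.squarefree⟩
  have hD8 : (-((s * q * l : ℕ) : ℤ)) % 8 = 1 := by
    have : (s * q * l) % 8 = 7 := by rw [Nat.mul_mod, Nat.mul_mod s q, hs8, hq8, hl8]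
    omega
  obtain ⟨hK, hdK⟩ := isImaginaryQuadratic_and_discr_sqrtField_of_squarefree_natAbs (-((s * q * l : ℕ) : ℤ))
    (by omega) hsf
  refine ⟨sqrtField (-((s * q * l : ℕ) : ℤ)), inferInstance, inferInstance, hK, hdK, ?_, hh _ hK hdK⟩
  refine satisfiesHeegnerHypothesis_sqrtField_of_squarefree_natAbs _ hD8 hsf fun r hr hrN => ?_
  rcases hN r hr hrN with rfl | rfl
  · exact Or.inl rfl
  · exact Or.inr hJ

/-- **Certificate (kernel value): `h(K′) < p` from Cohen's pair counter** — every imaginary quadratic `K` with `d_K = −n` (`n > 0`) has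
`h_K = h(−n) = classNumberCount n`. [cite: Cox2013, §2.A Thm. 2.13; §7.B Thm. 7.7(ii)] [cite: Cohen1993, §5.3.1 Algorithm 5.3.5] -/
theorem classNumber_lt_of_count_triple {p n : ℕ} (hn : 0 < n) (hh : BinQF.classNumberCount n < p) :
    ∀ (K : Type) [Field K] [NumberField K], IsImaginaryQuadratic K →
      NumberField.discr K = -(n : ℤ) → NumberField.classNumber K < p := by
  intro K _ _ hK hdK
  have hneg : (-(n : ℤ)) < 0 := by omega
  rw [ClassNumberValues.classNumber_eq_of_discr_eq hK.1 hdK hneg rfl, BinQF.classNumber_eq_classNumberCount hneg,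
    Int.natAbs_neg, Int.natAbs_natCast]
  exact hh

/-- **Certificate (size): `h(K′) < p` from Oesterlé's bound `h ≤ π⁻¹√|d| log|d|`** when `π⁻¹ √n log n < p` (tree
`classNumber_lt_of_sqrt_mul_log_lt`). [cite: Oesterle1988Gauss, II §3 Proposition p. 57 (27)] -/
theorem classNumber_lt_of_size_triple {p n : ℕ} (h4 : 4 < n) (hx : Real.pi⁻¹ * Real.sqrt n * Real.log n < p) :
    ∀ (K : Type) [Field K] [NumberField K], IsImaginaryQuadratic K →
      NumberField.discr K = -(n : ℤ) → NumberField.classNumber K < p := by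
  intro K _ _ hK hdK
  have h4' : 4 < (NumberField.discr K).natAbs := by rw [hdK, Int.natAbs_neg, Int.natAbs_natCast]; exact h4
  refine classNumber_lt_of_sqrt_mul_log_lt hK h4' ?_
  rw [hdK, Int.natAbs_neg, Int.natAbs_natCast]
  exact hx

end Field

/-! ## §3 ★★ The generic triple rung for `W = W_p⁻`, modulo Burungale–Tian only -/

section Corner

/-- The common final step: from the triple data `(s, q, ℓ)` to the `L`-value of the twist by `−sqℓ`. [folklore] -/
theorem L_twist_ne_zero_triple (hBT : burungaleTian_analyticRank_eq_zero_of_selmerCorank_eq_zero_of_hasCM) {p s q l : ℕ}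
    (hp : p.Prime) (hs : s.Prime) (hq : q.Prime) (hl : l.Prime) (hp8 : p % 8 = 7) (hs8 : s % 8 = 1) (hq8 : q % 8 = 3)
    (hl8 : l % 8 = 5) (hJs : jacobiSym (s : ℤ) p = -1) (hJq : jacobiSym (q : ℤ) p = -1) (hJl : jacobiSym (l : ℤ) p = -1) :
    ((⟨0, 0, 0, -(p : ℚ), 0⟩ : WeierstrassCurve ℚ).quadraticTwist ((-((s * q * l : ℕ) : ℤ) : ℤ) : ℚ)).entireLFunction 1 ≠ 0 := by
  haveI := Fact.mk hp; haveI := Fact.mk hs; haveI := Fact.mk hq; haveI := Fact.mk hl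
  have hnq : ¬ IsSquare ((q : ℤ) : ZMod p) := not_isSquare_of_jacobiSym_eq_neg_one hJq
  have hps : ¬ IsSquare ((p : ℤ) : ZMod s) := not_isSquare_mod_of_jacobiSym_eq_neg_one (by omega) (by omega) hJs
  have hpl : ¬ IsSquare ((p : ℤ) : ZMod l) := not_isSquare_mod_of_jacobiSym_eq_neg_one (by omega) (by omega) hJl
  rw [quadraticTwist_W]
  rw [show (-((-((s * q * l : ℕ) : ℤ)) ^ 2 * p) : ℤ) = (-(s ^ 2 * q ^ 2 * l ^ 2 * p) : ℤ) by push_cast; ring]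
  have hb : (-(s ^ 2 * q ^ 2 * l ^ 2 * p : ℤ)) ≠ 0 :=
    neg_ne_zero.mpr (mul_ne_zero (mul_ne_zero (mul_ne_zero (pow_ne_zero 2 (by exact_mod_cast hs.ne_zero))
      (pow_ne_zero 2 (by exact_mod_cast hq.ne_zero))) (pow_ne_zero 2 (by exact_mod_cast hl.ne_zero))) (by exact_mod_cast hp.ne_zero))
  have hab : (-(s ^ 2 * q ^ 2 * l ^ 2 * p : ℤ)) * ((0 : ℤ) ^ 2 - 4 * (-(s ^ 2 * q ^ 2 * l ^ 2 * p : ℤ))) ≠ 0 := by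
    refine mul_ne_zero hb ?_
    rw [show ((0 : ℤ) ^ 2 - 4 * (-(s ^ 2 * q ^ 2 * l ^ 2 * p : ℤ))) = 4 * (s ^ 2 * q ^ 2 * l ^ 2 * p) by ring]
    exact mul_ne_zero (by norm_num) (neg_ne_zero.mp hb)
  haveI := isElliptic_mk_of_ne_zero (F := ℚ) hab
  exact (L_one_ne_zero_triple_of_BT hBT hp8 hs8 hq8 hl8 hnq hps hpl).2

/-- ★★ **THE TRIPLE RUNG FOR `W = W_p⁻`, ONE NAMED FACT.** For every prime `p ≡ 7 (mod 8)` and all primes `s ≡ 1`, `q ≡ 3`, `ℓ ≡ 5 (mod 8)`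
with `(s/p) = (q/p) = (ℓ/p) = −1` and `h(K) < p` for every imaginary quadratic `K` of discriminant `−sqℓ` (e.g. by `classNumber_lt_of_count_triple`
or `classNumber_lt_of_size_triple`): there is a Heegner field `K′ = ℚ(√−sqℓ)` of `N(W_p⁻)` (`W_p⁻ : y² = x³ − p·x`; prime support `{2, p}`,
`−sqℓ ≡ 1 (mod 8)`, `(−sqℓ/p) = +1`) with `4 < |d_{K′}|`, `L(W_p⁻^{(d_{K′})}, 1) ≠ 0` (sharp `2`-isogeny descent of `y² = x³ − s²q²ℓ²p·x` —
UNCONDITIONAL and LEGENDRE-ONLY — then Burungale–Tian at `2` and the PROVED continuation), `h(K′) < p` and hence `p ∤ h(K′)` — the CONCLUSION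
of crux 21381 for `W = W_p⁻`, modulo Burungale–Tian ONLY. The binders `IsGloballyMinimal`, `NeZero N` mirror the crux and are unused.
[cite: BurungaleTian2026, Thm. 1.1] [cite: SilvermanAEC2009, Prop. X.4.9, Prop. X.4.7, Thm. X.4.2(a)] [cite: IrelandRosen1990, Ch. 18 §6 Theorem 7] -/
theorem cruxOnQuarticMinusCornerTriple_of_BT (hBT : burungaleTian_analyticRank_eq_zero_of_selmerCorank_eq_zero_of_hasCM) :
    ∀ (p : ℕ) [Fact p.Prime] [(⟨0, 0, 0, -(p : ℚ), 0⟩ : WeierstrassCurve ℚ).IsElliptic]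
      [(⟨0, 0, 0, -(p : ℚ), 0⟩ : WeierstrassCurve ℚ).IsGloballyMinimal]
      [NeZero ((⟨0, 0, 0, -(p : ℚ), 0⟩ : WeierstrassCurve ℚ).conductorNorm ℤ)],
      p % 8 = 7 → ∀ s q l : ℕ, s.Prime → q.Prime → l.Prime → s % 8 = 1 → q % 8 = 3 → l % 8 = 5 →
      jacobiSym (s : ℤ) p = -1 → jacobiSym (q : ℤ) p = -1 → jacobiSym (l : ℤ) p = -1 →
      (∀ (K : Type) [Field K] [NumberField K], IsImaginaryQuadratic K →
        NumberField.discr K = -((s * q * l : ℕ) : ℤ) → NumberField.classNumber K < p) →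
      ∃ (K : Type) (_ : Field K) (_ : NumberField K),
        IsImaginaryQuadratic K ∧ 4 < (NumberField.discr K).natAbs ∧
        SatisfiesHeegnerHypothesis ((⟨0, 0, 0, -(p : ℚ), 0⟩ : WeierstrassCurve ℚ).conductorNorm ℤ) K ∧
        ((⟨0, 0, 0, -(p : ℚ), 0⟩ : WeierstrassCurve ℚ).quadraticTwist (NumberField.discr K : ℚ)).entireLFunction 1 ≠ 0 ∧
        NumberField.classNumber K < p ∧ ¬ p ∣ NumberField.classNumber K := by
  intro p hpF _ _ _ hp8 s q l hs hq hl hs8 hq8 hl8 hJs hJq hJl hh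
  have hp : p.Prime := hpF.out
  obtain ⟨K, iF, iN, hK, hdK, hH', hcl⟩ := exists_witnessField_triple (N := (⟨0, 0, 0, -(p : ℚ), 0⟩ : WeierstrassCurve ℚ).conductorNorm ℤ)
    hs hs8 hq hq8 hl hl8 (jacobiSym_neg_triple_eq_one (by omega) hJs hJq hJl) hh
    (fun r hr hrN => eq_two_or_eq_of_prime_dvd_conductorNorm_W hp hr hrN)
  refine ⟨K, iF, iN, hK, ?_, hH', ?_, hcl, fun hdvd => absurd (Nat.le_of_dvd (NumberField.classNumber_pos K) hdvd) (not_le.mpr hcl)⟩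
  · rw [hdK, Int.natAbs_neg, Int.natAbs_natCast]
    have h9 : 9 ≤ s := by have := hs.two_le; omega
    have h3 : 3 ≤ q := by have := hq.two_le; omega
    have h5 : 5 ≤ l := by have := hl.two_le; omega
    calc 4 < 9 * 3 * 5 := by norm_num
      _ ≤ s * q * l := Nat.mul_le_mul (Nat.mul_le_mul h9 h3) h5
  · rw [hdK]
    exact L_twist_ne_zero_triple hBT hp hs hq hl hp8 hs8 hq8 hl8 hJs hJq hJl

end Corner

/-! ## §4 The crux's instance binders for the literal `W_p⁻` -/

section Binders

/-- **`W_p⁻ : y² = x³ − p·x` is an elliptic curve** (`p` prime). [folklore] -/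
theorem isElliptic_Wminus (p : ℕ) [Fact p.Prime] : (⟨0, 0, 0, -(p : ℚ), 0⟩ : WeierstrassCurve ℚ).IsElliptic := by
  have h := XCubeAddDX.isElliptic_xD (D := -(p : ℤ)) (neg_ne_zero.mpr (by exact_mod_cast (Fact.out : p.Prime).ne_zero))
  simpa only [Int.cast_neg, Int.cast_natCast] using h

open Literature.NumberTheory.EllipticCurves.Rank1Residual.X11RankOneCertificates in
/-- **`W_p⁻` (`p` an odd prime) is a global minimal model**: the integer model `[0, 0, 0, −p, 0]` has `Δ = 64 p³` (`ord_2 Δ = 6 < 12`,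
`ord_p Δ = 3 < 12`), so no prime `q` has `q¹² ∣ Δ` (Silverman VII.1 Remark 1.1 at every place; the tree's `isGloballyMinimal_of_int_criterion`).
[cite: SilvermanAEC2009, VII.1 Remark 1.1] -/
theorem isGloballyMinimal_Wminus {p : ℕ} (hp : p.Prime) (hp2 : p ≠ 2) :
    (⟨0, 0, 0, -(p : ℚ), 0⟩ : WeierstrassCurve ℚ).IsGloballyMinimal := by
  have h := isGloballyMinimal_of_int_criterion 0 0 0 (-(p : ℤ)) 0 ?_
  · simpa only [Int.cast_zero, Int.cast_neg, Int.cast_natCast] using h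
  · rintro q hq ⟨h12, -⟩
    have hΔ : discOf [0, 0, 0, -(p : ℤ), 0] = 64 * (p : ℤ) ^ 3 := by
      simp only [discOf, invariants]
      ring
    rw [hΔ] at h12
    have h12' : q ^ 12 ∣ 64 * p ^ 3 := by
      have := Int.natAbs_dvd_natAbs.mpr h12
      simpa [Int.natAbs_mul, Int.natAbs_pow] using this
    by_cases hq2 : q = 2
    · subst hq2
      have hcop : Nat.Coprime (2 ^ 12) (p ^ 3) :=
        Nat.Coprime.pow _ _ ((Nat.coprime_primes Nat.prime_two hp).mpr (Ne.symm hp2))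
      have h64 : 2 ^ 12 ∣ 64 := hcop.dvd_of_dvd_mul_right h12'
      have := Nat.le_of_dvd (by norm_num) h64
      omega
    · have hcop : Nat.Coprime (q ^ 12) 64 := by
        rw [show (64 : ℕ) = 2 ^ 6 by norm_num]
        exact Nat.Coprime.pow _ _ ((Nat.coprime_primes hq Nat.prime_two).mpr hq2)
      have hqp : q ^ 12 ∣ p ^ 3 := hcop.dvd_of_dvd_mul_left h12'
      have hq1 : q ∣ p := hq.dvd_of_dvd_pow (dvd_trans (dvd_pow_self q (by norm_num)) hqp)
      have hqeq : q = p := (Nat.prime_dvd_prime_iff_eq hq hp).mp hq1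
      subst hqeq
      have := (Nat.pow_dvd_pow_iff_le_right hq.one_lt).mp hqp
      omega

/-- **The only bad prime `≥ 5` of `W_n⁻` is `n`** (`n` prime): `W_n⁻` has good reduction at every prime not dividing `2n`
(bed-w4 g13's `hasGoodReductionAtPrime_W`). [cite: SilvermanAEC2009, VII.5 Prop. 5.1(a)] -/
theorem eq_of_not_good_Wminus {n p : ℕ} [Fact p.Prime] (hn : n.Prime) (h5 : 5 ≤ p)
    (hbad : ¬ Literature.NumberTheory.EllipticCurves.Rank1Residual.Good (⟨0, 0, 0, -(n : ℚ), 0⟩ : WeierstrassCurve ℚ) p) : p = n := by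
  have hp : p.Prime := Fact.out
  by_contra hne
  refine hbad (hasGoodReductionAtPrime_W fun hdvd => ?_)
  rcases (Nat.Prime.dvd_mul hp).mp hdvd with h2 | h
  · have := (Nat.prime_dvd_prime_iff_eq hp Nat.prime_two).mp h2
    omega
  · exact hne ((Nat.prime_dvd_prime_iff_eq hp hn).mp h)

end Binders

end Summit.BirchSwinnertonDyer.BirchSwinnertonDyer.Theorems.BiquadraticEisensteinDescentHeegnerTwistCouplingInSupplyQuarticMinusTripleCorner

end
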